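import Summits.BirchSwinnertonDyer.Rank1Residual.Additive.X4RankZeroSemistableTwistAnyOdd
import HarnessLib

/-!
# X4 / X3 rank `0`, the UPPER half with the CONTROL INPUT ABSTRACTED: the two additive-twist assembly
# cores re-run on a POINTWISE supplier of `p ^ (ord_p #Ш[p^∞] + ord_p ∏ᶠ_{v∤p} c_v) ∣ g(0) · #E(ℚ)²`
# in place of the named fact `Delbourgo1998.prop4_rankZero_pow_dvd_constantCoeff`
# (team n1011, row T-CTL-UP, seat p06 GEN 11, FILE 3a — the socket the Prop-4.14 road plugs into)

HONEST FRAMING (cell `b2b-bsdres-*`, team n1011, verbatim): prove what is provable now; shrink each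
hard class to its core with data; no claim beyond stated classes. Research route on
CONSTRUCTION-SHAPED X4 / §I N10–N11; TOOL + ASSEMBLY theorems only — no definition, no named fact,
nothing booked, no residual-map mark moved, no class closed. NOTHING of additive-p4's is edited: the
two cores below are NEW declarations whose proof bodies are additive-p4's
(`X4RankZeroSemistableTwistEven` / `…Odd`, lines V9/V9b) token for token except at step [A], where the
single call `hDel W p hp2 hadd hGM hr hfin hE κ γ hκ hγ D` is replaced by the binder `hdivAt`.

## What and why

Every rank-`0` upper-half END of the additive classes reads the control theorem at the additive
prime through the named fact `hDel : Delbourgo1998.prop4_rankZero_pow_dvd_constantCoeff` (size L, no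
`_holds` expected), and only through its conclusion AT THE PAIR. Row T-CTL-UP (FILES 1–2,
`Iwasawa/SelmerCardMulKerGDvdConstantCoeff`, `Additive/ShaDvdConstantCoeffOfNoFiniteSubmodule`) proves
that conclusion on the `B = 0` rows from Greenberg's Prop. 4.14 record + control. To let EITHER
supplier feed the assemblies without touching them, this file abstracts the input:

* `AdditiveTwistEven.missingUpperBoundAt_of_leadingTerm_of_shaDvd` — the even core (`p ≡ 1 (mod 4)`):
  `hdivAt` + the pointwise leading term `hLT` + GZK + modularity ⇒ `Typed.MissingUpperBoundAt W p`;
* `AdditiveTwistOdd.shaOrder_le_of_leadingTerm_of_shaDvd` — the odd core (`p ≡ 3 (mod 4)`):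
  ⇒ `#Ш_an = q` with `ord_p #Ш ≤ ord_p q + ord_p c_p`;
* `AdditiveTwistEven.shaDvdAt_of_prop4`, `…` — Delbourgo's record IS a supplier (so nothing is lost):
  `hDel → hdivAt` on the additive (G)-ordinary-or-`ord_p j < 0` rows in rank `0`.

FILE 3b (`Additive/GordRankZeroUpperHalfOfProp414`) plugs the Prop-4.14 supplier in and re-derives the
X4♯(G-ord) ∩ `I₀*` ENDs `…_of_katoComponent` with `hDel` REPLACED by `h414` + place data + `B = 0`.
Axioms standard.

References: [Delbourgo1998] Prop. 4 (p. 144) — shape only; [Kato2004Asterisque] Thm. 17.4;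
[Miller2011LMS] Def. 1.1; [GreenbergLNM1716] §4; cells/n1011/skel/T-CTL-UP.md.
-/

noncomputable section

open scoped Classical MatrixGroups ModularForm

open CongruenceSubgroup WeierstrassCurve Literature.NumberTheory.EllipticCurves
  Literature.NumberTheory.EllipticCurves.ModularForms
  Literature.NumberTheory.EllipticCurves.Rank1Residual

namespace Summit.BirchSwinnertonDyer.Rank1Residual.Additive

section Cores

open IsDedekindDomain NumberField Rat.HeightOneSpectrum
  Literature.NumberTheory.EllipticCurves.Rank1Residual.Typed

variable (W : WeierstrassCurve ℚ) [W.IsElliptic] [W.IsGloballyMinimal] (p : ℕ) [hp : Fact p.Prime]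

/-- **Class-agnostic even core with the control input ABSTRACTED (rank `0`, `p ≡ 1 (mod 4)`).** The
tree's `AdditiveTwistEven.missingUpperBoundAt_of_leadingTerm` (additive-p4, line V9b) verbatim, with
its ONE use of the named fact `Delbourgo1998.prop4_rankZero_pow_dvd_constantCoeff` — the divisibility
`p ^ (ord_p #Ш[p^∞] + ord_p ∏ᶠ_{v∤p} c_v) ∣ g(0) · #E(ℚ)²` for `g ∈ char_Λ X(E/ℚ_∞)`, cyclotomic `κ` —
replaced by a POINTWISE supplier `hdivAt` of exactly that statement at the pair `(W, p)`. Suppliers: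
Delbourgo's record itself (`hDel W p hp2 hadd hGM hr`), or row T-CTL-UP's
`isTorsion_and_pow_dvd_constantCoeff_mul_sq_of_prop414` (Greenberg's Prop. 4.14 record + control, on
the `B = 0` rows). For `W = C • V^{(p)}`, `V` good ordinary or multiplicative at `p`, `f` the newform
of `V`, `ϖ·Ω_V = Ω⁺_f`: `hdivAt` + `hLT` + even Birch + Pal + `ord_p u(C) = 0` + `c_p ≤ 4 < p` + GZK +
modularity ⇒ **`Typed.MissingUpperBoundAt W p`**. Proof body = additive-p4's, token for token but [A].
[cite: Delbourgo1998, Prop. 4 (p. 144) (shape of the abstracted input only)] [cite: Miller2011LMS, Def. 1.1] -/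
theorem AdditiveTwistEven.missingUpperBoundAt_of_leadingTerm_of_shaDvd
    (hdivAt : ∀ (κ : ZpExtension ℚ p) (γ : Field.absoluteGaloisGroup ℚ), κ.IsCyclotomic →
      κ.IsTopGenerator γ → ∀ D : W.SelmerDualData κ γ, Finite W.sha → Finite W.toAffine.Point →
      ∀ g ∈ D.charIdeal,
        (p : ℤ_[p]) ^ (padicValNat p (Nat.card (AddCommGroup.primaryComponent W.sha p)) +
            padicValNat p (∏ᶠ v : HeightOneSpectrum (𝓞 ℚ),
              if (p : 𝓞 ℚ) ∈ v.asIdeal then 1 else W.tamagawaNumberAt v)) ∣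
          PowerSeries.constantCoeff g * ((Nat.card W.toAffine.Point : ℕ) : ℤ_[p]) ^ 2)
    (hGZK : rank_eq_analyticRank_of_analyticRank_le_one) (hmod : hasEntireLFunction_rat)
    (hp4 : p % 4 = 1) (hr : W.analyticRank = 0) (hadd : Addv W p)
    (V : WeierstrassCurve ℚ) [V.IsElliptic] [V.IsGloballyMinimal]
    (C : VariableChange ℚ) (hC : C • V.quadraticTwist (p : ℚ) = W) (hV : GoodOrd V p ∨ Mult V p)
    {N : ℕ} [NeZero N] {f : CuspForm (Gamma0 N) 2} (hf : IsNewformOf V f)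
    (ϖ : ℚ) (hϖ : (ϖ : ℝ) * V.realPeriodRat = plusPeriod f)
    (hLT : ∀ (κ : ZpExtension ℚ p) (γ : Field.absoluteGaloisGroup ℚ),
      κ.IsCyclotomic → κ.IsTopGenerator γ → IsCyclotomicVariable p γ →
      ∀ D : W.SelmerDualData κ γ, ∃ g ∈ D.charIdeal, ∃ u : ℤ_[p]ˣ,
        ((PowerSeries.constantCoeff g : ℤ_[p]) : ℚ_[p]) =
          ((u : ℤ_[p]) : ℚ_[p]) * (ϖ : ℚ_[p]) * (legendrePlusSymbolSum f p : ℚ_[p])) :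
    MissingUpperBoundAt W p := by
  classical
  have hpP : p.Prime := hp.out
  have hp2 : p ≠ 2 := by omega
  have hp5 : 5 ≤ p := five_le_of_prime_of_mod_four_eq_one p hp4 hpP
  set v₀ : HeightOneSpectrum (𝓞 ℚ) := (primesEquiv (R := 𝓞 ℚ)).symm ⟨p, hp.out⟩ with hv₀
  -- `ord_p u(C) = 0` (the twisted model is `p`-minimal)
  have hC' : C • V.quadraticTwist (((p : ℤ)) : ℚ) = W := by push_cast; exact hC
  have hu : padicValRat p (C.u : ℚ) = 0 :=
    padicValRat_u_eq_zero_of_twist_pm_p p hp2 V W (hV.elim (fun h ↦ Or.inl h.1) Or.inr)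
      (Or.inl rfl) C hC'
  -- rank 0: `L(E,1) ≠ 0`, `E(ℚ)` and `Ш` finite
  have hL : W.entireLFunction 1 ≠ 0 := (W.analyticRank_eq_zero_iff_holds (hmod W)).mp hr
  obtain ⟨hmw, hfin⟩ := hGZK W (by rw [hr]; exact zero_le_one)
  have hmw0 : W.mordellWeilRank = 0 := by rw [hmw, hr]
  haveI : Finite W.sha := hfin
  haveI hE : Finite W.toAffine.Point := W.finite_point_of_rank_zero hmw0
  -- the cyclotomic setting and `X(E/ℚ_∞)`
  obtain ⟨κ, hκ, γ, hγ, hγ'⟩ := exists_isCyclotomic_isTopGenerator_isCyclotomicVariable_holds p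
  obtain ⟨D⟩ := W.nonempty_selmerDualData_holds κ γ hγ
  obtain ⟨g, hgmem, u, hg0⟩ := hLT κ γ hκ hγ hγ' D
  -- [A]: the UPPER half of control at this pair (abstract supplier `hdivAt`)
  have hdvd := hdivAt κ γ hκ hγ D hfin hE g hgmem
  -- analytic side (no period fact)
  obtain ⟨ε, hε, hLq⟩ := entireLFunction_one_eq_of_twist_explicit p hmod hp4 V W C hC hadd hf ϖ hϖ
  set S : ℚ := legendrePlusSymbolSum f p with hS
  set q : ℚ := ε * (ϖ * S) / |(C.u : ℚ)| with hq
  have hΩ : (W.realPeriodRat : ℂ) ≠ 0 := by exact_mod_cast W.realPeriodRat_pos_holds.ne'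
  have hq' : W.entireLFunction 1 / (W.realPeriodRat : ℂ) = (q : ℂ) := by
    rw [hLq, mul_div_cancel_right₀ _ hΩ]
  obtain ⟨-, -, -, hshaAn⟩ := Wuthrich2014.shaAn_eq_of_L_one_div_eq hGZK W hL hq'
  -- non-vanishing and the valuation of `q`
  have hua0 : |(C.u : ℚ)| ≠ 0 := abs_ne_zero.mpr C.u.ne_zero
  have hϖS : ϖ * S ≠ 0 := by
    intro h0
    apply hL
    rw [hLq, hq, h0, mul_zero, zero_div, Rat.cast_zero, zero_mul]
  have hε0 : ε ≠ 0 := by rcases hε with h | h <;> rw [h] <;> norm_num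
  have hq0 : q ≠ 0 := by
    rw [hq]
    exact div_ne_zero (mul_ne_zero hε0 hϖS) hua0
  have hvε : padicValRat p ε = 0 := by
    rcases hε with h | h
    · rw [h, padicValRat.one]
    · rw [h, padicValRat.neg, padicValRat.one]
  have hvua : padicValRat p |(C.u : ℚ)| = 0 := by
    rcases abs_choice (C.u : ℚ) with h | h
    · rw [h, hu]
    · rw [h, padicValRat.neg, hu]
  have hvq : padicValRat p q = padicValRat p (ϖ * S) := by
    rw [hq, padicValRat.div (mul_ne_zero hε0 hϖS) hua0, padicValRat.mul hε0 hϖS, hvε, hvua]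
    ring
  -- names for the arithmetic quantities
  set T : ℕ := Nat.card W.toAffine.Point with hT
  set c : ℕ := W.tamagawaNumberAt v₀ with hc
  set P' : ℕ := ∏ᶠ v : HeightOneSpectrum (𝓞 ℚ),
    (if (p : 𝓞 ℚ) ∈ v.asIdeal then 1 else W.tamagawaNumberAt v) with hP'
  have hT0 : T ≠ 0 := by rw [hT]; exact Nat.card_pos.ne'
  have hPsplit : W.tamagawaProduct = c * P' := tamagawaProduct_eq_tamagawaNumberAt_mul_finprod W p
  have hPpos : 0 < W.tamagawaProduct := W.tamagawaProduct_pos_holds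
  have hc0 : c ≠ 0 := fun h ↦ by rw [hPsplit, h, zero_mul] at hPpos; exact lt_irrefl 0 hPpos
  have hP'0 : P' ≠ 0 := fun h ↦ by rw [hPsplit, h, mul_zero] at hPpos; exact lt_irrefl 0 hPpos
  have hvc : padicValNat p c = 0 := padicValNat_tamagawaNumberAt_eq_zero_of_addv W p hadd hp5
  have hvP : padicValNat p W.tamagawaProduct = padicValNat p P' := by
    rw [hPsplit, padicValNat.mul hc0 hP'0, hvc, zero_add]
  have hsha : padicValNat p (Nat.card (AddCommGroup.primaryComponent W.sha p)) =
      padicValNat p W.shaOrder := by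
    unfold WeierstrassCurve.shaOrder
    exact padicValNat_card_addPrimaryComponent p
  -- the divisibility in `ℤ_p`, read as an inequality of valuations in `ℚ_p`
  set g0 : ℚ_[p] := ((PowerSeries.constantCoeff g : ℤ_[p]) : ℚ_[p]) with hg0def
  have hg0S : g0 = ((u : ℤ_[p]) : ℚ_[p]) * ((ϖ * S : ℚ) : ℚ_[p]) := by
    rw [hg0]
    push_cast
    ring
  have hϖSQ : ((ϖ * S : ℚ) : ℚ_[p]) ≠ 0 := by exact_mod_cast hϖS
  have hg0ne : g0 ≠ 0 := by
    rw [hg0S]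
    exact mul_ne_zero (coe_units_ne_zero p u) hϖSQ
  have hvg0 : g0.valuation = padicValRat p (ϖ * S) := by
    rw [hg0S, Padic.valuation_mul (coe_units_ne_zero p u) hϖSQ, valuation_coe_units_eq_zero,
      zero_add, Padic.valuation_ratCast]
  have hTQ : ((T : ℕ) : ℚ_[p]) ≠ 0 := by exact_mod_cast hT0
  obtain ⟨c', hc'⟩ := hdvd
  have hkey : g0 * ((T : ℕ) : ℚ_[p]) ^ 2 =
      (p : ℚ_[p]) ^ (padicValNat p (Nat.card (AddCommGroup.primaryComponent W.sha p)) +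
        padicValNat p P') * ((c' : ℤ_[p]) : ℚ_[p]) := by
    have h := congrArg ((↑) : ℤ_[p] → ℚ_[p]) hc'
    push_cast at h
    rw [hg0def]
    exact h
  have hlhs0 : g0 * ((T : ℕ) : ℚ_[p]) ^ 2 ≠ 0 := mul_ne_zero hg0ne (pow_ne_zero 2 hTQ)
  have hc'0 : ((c' : ℤ_[p]) : ℚ_[p]) ≠ 0 := by
    intro h0
    rw [h0, mul_zero] at hkey
    exact hlhs0 hkey
  have hpQ : (p : ℚ_[p]) ≠ 0 := by exact_mod_cast hpP.ne_zero
  have hval := congrArg Padic.valuation hkey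
  rw [Padic.valuation_mul hg0ne (pow_ne_zero 2 hTQ), Padic.valuation_pow, Padic.valuation_natCast,
    hvg0, Padic.valuation_mul (pow_ne_zero _ hpQ) hc'0, Padic.valuation_pow, Padic.valuation_p,
    mul_one, hsha] at hval
  have hc'val : 0 ≤ (((c' : ℤ_[p]) : ℚ_[p])).valuation := PadicInt.valuation_coe_nonneg
  have hineq : (padicValNat p W.shaOrder : ℤ) + padicValNat p P' ≤
      padicValRat p (ϖ * S) + 2 * (padicValNat p T : ℤ) := by
    simp only [Nat.cast_add, Nat.cast_ofNat] at hval
    linarith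
  -- conclusion
  refine ⟨q * (T : ℚ) ^ 2 / (W.tamagawaProduct : ℚ), ?_, ?_⟩
  · rw [hshaAn]
  · have hTq : (T : ℚ) ≠ 0 := by exact_mod_cast hT0
    have hPq : (W.tamagawaProduct : ℚ) ≠ 0 := by exact_mod_cast hPpos.ne'
    rw [padicValRat.div (mul_ne_zero hq0 (pow_ne_zero 2 hTq)) hPq,
      padicValRat.mul hq0 (pow_ne_zero 2 hTq), padicValRat.pow, padicValRat.of_nat,
      padicValRat.of_nat, hvq, hvP]
    simp only [Nat.cast_ofNat]
    linarith



/-- **Class-agnostic odd core with the control input ABSTRACTED (rank `0`, `p ≡ 3 (mod 4)`).** The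
tree's `AdditiveTwistOdd.shaOrder_le_of_leadingTerm` (additive-p4) verbatim, with its ONE use of
`Delbourgo1998.prop4_rankZero_pow_dvd_constantCoeff` replaced by the pointwise supplier `hdivAt` (see
the even core). For `W = C • V^{(−p)}` (the reduction hypothesis on `V` was used only through `hDel` and
is DROPPED), `ord_p u(C) = 0`,
`f` the newform of `V`, `ϖ⁻·|Ω⁻(V)| = Ω⁻_f`: `hdivAt` + `hLT` + odd Birch + Pal (`d < 0`) +
Kodaira–Néron + GZK + modularity ⇒ `#Ш_an(E) = q ∈ ℚ` with **`ord_p #Ш(E) ≤ ord_p q + ord_p c_p(E)`**.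
[cite: Delbourgo1998, Prop. 4 (p. 144) (shape of the abstracted input only)] [cite: Miller2011LMS, Def. 1.1] -/
theorem AdditiveTwistOdd.shaOrder_le_of_leadingTerm_of_shaDvd
    (hdivAt : ∀ (κ : ZpExtension ℚ p) (γ : Field.absoluteGaloisGroup ℚ), κ.IsCyclotomic →
      κ.IsTopGenerator γ → ∀ D : W.SelmerDualData κ γ, Finite W.sha → Finite W.toAffine.Point →
      ∀ g ∈ D.charIdeal,
        (p : ℤ_[p]) ^ (padicValNat p (Nat.card (AddCommGroup.primaryComponent W.sha p)) +
            padicValNat p (∏ᶠ v : HeightOneSpectrum (𝓞 ℚ),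
              if (p : 𝓞 ℚ) ∈ v.asIdeal then 1 else W.tamagawaNumberAt v)) ∣
          PowerSeries.constantCoeff g * ((Nat.card W.toAffine.Point : ℕ) : ℤ_[p]) ^ 2)
    (hGZK : rank_eq_analyticRank_of_analyticRank_le_one) (hmod : hasEntireLFunction_rat)
    (hp4 : p % 4 = 3) (hr : W.analyticRank = 0) (hadd : Addv W p)
    (V : WeierstrassCurve ℚ) [V.IsElliptic] [V.IsGloballyMinimal]
    (C : VariableChange ℚ) (hC : C • V.quadraticTwist (-(p : ℚ)) = W)
    (hu : padicValRat p (C.u : ℚ) = 0)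
    {N : ℕ} [NeZero N] {f : CuspForm (Gamma0 N) 2} (hf : IsNewformOf V f)
    (ϖ : ℚ) (hϖ : (ϖ : ℝ) * V.imaginaryPeriodRat = minusPeriod f)
    (hLT : ∀ (κ : ZpExtension ℚ p) (γ : Field.absoluteGaloisGroup ℚ),
      κ.IsCyclotomic → κ.IsTopGenerator γ → IsCyclotomicVariable p γ →
      ∀ D : W.SelmerDualData κ γ, ∃ g ∈ D.charIdeal, ∃ u : ℤ_[p]ˣ,
        ((PowerSeries.constantCoeff g : ℤ_[p]) : ℚ_[p]) =
          ((u : ℤ_[p]) : ℚ_[p]) * (ϖ : ℚ_[p]) * (legendreMinusSymbolSum f p : ℚ_[p])) :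
    ∃ q : ℚ, shaAn W = (q : ℂ) ∧
      (padicValNat p W.shaOrder : ℤ) ≤
        padicValRat p q + padicValNat p (W.tamagawaNumberAt ((primesEquiv (R := 𝓞 ℚ)).symm ⟨p, hp.out⟩)) := by
  classical
  have hpP : p.Prime := hp.out
  have hp2 : p ≠ 2 := by omega
  set v₀ : HeightOneSpectrum (𝓞 ℚ) := (primesEquiv (R := 𝓞 ℚ)).symm ⟨p, hp.out⟩ with hv₀
  -- rank 0: `L(E,1) ≠ 0`, `E(ℚ)` and `Ш` finite
  have hL : W.entireLFunction 1 ≠ 0 := (W.analyticRank_eq_zero_iff_holds (hmod W)).mp hr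
  obtain ⟨hmw, hfin⟩ := hGZK W (by rw [hr]; exact zero_le_one)
  have hmw0 : W.mordellWeilRank = 0 := by rw [hmw, hr]
  haveI : Finite W.sha := hfin
  haveI hE : Finite W.toAffine.Point := W.finite_point_of_rank_zero hmw0
  -- the cyclotomic setting and `X(E/ℚ_∞)`
  obtain ⟨κ, hκ, γ, hγ, hγ'⟩ := exists_isCyclotomic_isTopGenerator_isCyclotomicVariable_holds p
  obtain ⟨D⟩ := W.nonempty_selmerDualData_holds κ γ hγ
  -- [B∘C](0), odd branch
  obtain ⟨g, hgmem, u, hg0⟩ := hLT κ γ hκ hγ hγ' D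
  -- [A]: the UPPER half of control at this pair (abstract supplier `hdivAt`)
  have hdvd := hdivAt κ γ hκ hγ D hfin hE g hgmem
  -- [E⁻] + [F] + odd Birch
  obtain ⟨ε, hε, hLq⟩ := entireLFunction_one_eq_of_twist_neg p hmod hp4 V W C hC hadd hf ϖ hϖ
  set S : ℚ := legendreMinusSymbolSum f p with hS
  set cinf : ℕ := (W.baseChange ℝ).numRealComponents with hcinf
  set q : ℚ := ε * (ϖ * S) / (|(C.u : ℚ)| * (cinf : ℚ)) with hq
  have hΩ : (W.realPeriodRat : ℂ) ≠ 0 := by exact_mod_cast W.realPeriodRat_pos_holds.ne'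
  have hq' : W.entireLFunction 1 / (W.realPeriodRat : ℂ) = (q : ℂ) := by
    rw [hLq, mul_div_cancel_right₀ _ hΩ]
  obtain ⟨-, -, -, hshaAn⟩ := Wuthrich2014.shaAn_eq_of_L_one_div_eq hGZK W hL hq'
  -- non-vanishing and the valuation of `q`
  have hua0 : |(C.u : ℚ)| ≠ 0 := abs_ne_zero.mpr C.u.ne_zero
  have hcinf0 : (cinf : ℚ) ≠ 0 := by
    rw [hcinf, numRealComponents]
    split_ifs <;> norm_num
  have hden0 : |(C.u : ℚ)| * (cinf : ℚ) ≠ 0 := mul_ne_zero hua0 hcinf0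
  have hϖS : ϖ * S ≠ 0 := by
    intro h0
    apply hL
    rw [hLq, hq, h0, mul_zero, zero_div, Rat.cast_zero, zero_mul]
  have hε0 : ε ≠ 0 := by rcases hε with h | h <;> rw [h] <;> norm_num
  have hq0 : q ≠ 0 := by
    rw [hq]
    exact div_ne_zero (mul_ne_zero hε0 hϖS) hden0
  have hvε : padicValRat p ε = 0 := by
    rcases hε with h | h
    · rw [h, padicValRat.one]
    · rw [h, padicValRat.neg, padicValRat.one]
  have hvua : padicValRat p |(C.u : ℚ)| = 0 := by
    rcases abs_choice (C.u : ℚ) with h | h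
    · rw [h, hu]
    · rw [h, padicValRat.neg, hu]
  have hvq : padicValRat p q = padicValRat p (ϖ * S) := by
    rw [hq, padicValRat.div (mul_ne_zero hε0 hϖS) hden0, padicValRat.mul hε0 hϖS,
      padicValRat.mul hua0 hcinf0, hvε, hvua, padicValRat_numRealComponents_eq_zero W p hp2]
    ring
  -- names for the arithmetic quantities
  set T : ℕ := Nat.card W.toAffine.Point with hT
  set c : ℕ := W.tamagawaNumberAt v₀ with hc
  set P' : ℕ := ∏ᶠ v : HeightOneSpectrum (𝓞 ℚ),
    (if (p : 𝓞 ℚ) ∈ v.asIdeal then 1 else W.tamagawaNumberAt v) with hP'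
  have hT0 : T ≠ 0 := by rw [hT]; exact Nat.card_pos.ne'
  have hPsplit : W.tamagawaProduct = c * P' := tamagawaProduct_eq_tamagawaNumberAt_mul_finprod W p
  have hPpos : 0 < W.tamagawaProduct := W.tamagawaProduct_pos_holds
  have hc0 : c ≠ 0 := fun h ↦ by rw [hPsplit, h, zero_mul] at hPpos; exact lt_irrefl 0 hPpos
  have hP'0 : P' ≠ 0 := fun h ↦ by rw [hPsplit, h, mul_zero] at hPpos; exact lt_irrefl 0 hPpos
  have hvP : padicValNat p W.tamagawaProduct = padicValNat p c + padicValNat p P' := by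
    rw [hPsplit, padicValNat.mul hc0 hP'0]
  have hsha : padicValNat p (Nat.card (AddCommGroup.primaryComponent W.sha p)) =
      padicValNat p W.shaOrder := by
    unfold WeierstrassCurve.shaOrder
    exact padicValNat_card_addPrimaryComponent p
  -- the divisibility in `ℤ_p`, read as an inequality of valuations in `ℚ_p`
  set g0 : ℚ_[p] := ((PowerSeries.constantCoeff g : ℤ_[p]) : ℚ_[p]) with hg0def
  have hg0S : g0 = ((u : ℤ_[p]) : ℚ_[p]) * ((ϖ * S : ℚ) : ℚ_[p]) := by
    rw [hg0]
    push_cast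
    ring
  have hϖSQ : ((ϖ * S : ℚ) : ℚ_[p]) ≠ 0 := by exact_mod_cast hϖS
  have hg0ne : g0 ≠ 0 := by
    rw [hg0S]
    exact mul_ne_zero (coe_units_ne_zero p u) hϖSQ
  have hvg0 : g0.valuation = padicValRat p (ϖ * S) := by
    rw [hg0S, Padic.valuation_mul (coe_units_ne_zero p u) hϖSQ, valuation_coe_units_eq_zero,
      zero_add, Padic.valuation_ratCast]
  have hTQ : ((T : ℕ) : ℚ_[p]) ≠ 0 := by exact_mod_cast hT0
  obtain ⟨c', hc'⟩ := hdvd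
  have hkey : g0 * ((T : ℕ) : ℚ_[p]) ^ 2 =
      (p : ℚ_[p]) ^ (padicValNat p (Nat.card (AddCommGroup.primaryComponent W.sha p)) +
        padicValNat p P') * ((c' : ℤ_[p]) : ℚ_[p]) := by
    have h := congrArg ((↑) : ℤ_[p] → ℚ_[p]) hc'
    push_cast at h
    rw [hg0def]
    exact h
  have hlhs0 : g0 * ((T : ℕ) : ℚ_[p]) ^ 2 ≠ 0 := mul_ne_zero hg0ne (pow_ne_zero 2 hTQ)
  have hc'0 : ((c' : ℤ_[p]) : ℚ_[p]) ≠ 0 := by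
    intro h0
    rw [h0, mul_zero] at hkey
    exact hlhs0 hkey
  have hpQ : (p : ℚ_[p]) ≠ 0 := by exact_mod_cast hpP.ne_zero
  have hval := congrArg Padic.valuation hkey
  rw [Padic.valuation_mul hg0ne (pow_ne_zero 2 hTQ), Padic.valuation_pow, Padic.valuation_natCast,
    hvg0, Padic.valuation_mul (pow_ne_zero _ hpQ) hc'0, Padic.valuation_pow, Padic.valuation_p,
    mul_one, hsha] at hval
  have hc'val : 0 ≤ (((c' : ℤ_[p]) : ℚ_[p])).valuation := PadicInt.valuation_coe_nonneg
  have hineq : (padicValNat p W.shaOrder : ℤ) + padicValNat p P' ≤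
      padicValRat p (ϖ * S) + 2 * (padicValNat p T : ℤ) := by
    simp only [Nat.cast_add, Nat.cast_ofNat] at hval
    linarith
  -- conclusion
  refine ⟨q * (T : ℚ) ^ 2 / (W.tamagawaProduct : ℚ), ?_, ?_⟩
  · rw [hshaAn]
  · have hTq : (T : ℚ) ≠ 0 := by exact_mod_cast hT0
    have hPq : (W.tamagawaProduct : ℚ) ≠ 0 := by exact_mod_cast hPpos.ne'
    rw [padicValRat.div (mul_ne_zero hq0 (pow_ne_zero 2 hTq)) hPq,
      padicValRat.mul hq0 (pow_ne_zero 2 hTq), padicValRat.pow, padicValRat.of_nat,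
      padicValRat.of_nat, hvq, hvP]
    simp only [Nat.cast_ofNat, Nat.cast_add]
    linarith



/-- **Delbourgo's record is a supplier of `hdivAt`** on an additive rank-`0` pair that is
(G)-ordinary or has `ord_p j < 0` (`hGM`), `p ≠ 2`: nothing of the existing ENDs is lost by the
abstraction. [cite: Delbourgo1998, Thm. 3 (p. 143) and Prop. 4 (p. 144)] -/
theorem shaDvdAt_of_prop4 (hDel : Delbourgo1998.prop4_rankZero_pow_dvd_constantCoeff) (hp2 : p ≠ 2)
    (hadd : Addv W p)
    (hGM : (∃ (L : Type) (_ : Field L) (_ : NumberField L) (_ : IsCyclotomicExtension {p} ℚ L)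
        (F : IntermediateField ℚ L),
        ∀ w : HeightOneSpectrum (𝓞 F), (p : 𝓞 F) ∈ w.asIdeal →
          (W.baseChange F).HasGoodReductionAt w ∧ (W.baseChange F).HasUnitRootAt w) ∨
      padicValRat p W.j < 0)
    (hr : W.analyticRank = 0) :
    ∀ (κ : ZpExtension ℚ p) (γ : Field.absoluteGaloisGroup ℚ), κ.IsCyclotomic →
      κ.IsTopGenerator γ → ∀ D : W.SelmerDualData κ γ, Finite W.sha → Finite W.toAffine.Point →
      ∀ g ∈ D.charIdeal,
        (p : ℤ_[p]) ^ (padicValNat p (Nat.card (AddCommGroup.primaryComponent W.sha p)) +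
            padicValNat p (∏ᶠ v : HeightOneSpectrum (𝓞 ℚ),
              if (p : 𝓞 ℚ) ∈ v.asIdeal then 1 else W.tamagawaNumberAt v)) ∣
          PowerSeries.constantCoeff g * ((Nat.card W.toAffine.Point : ℕ) : ℤ_[p]) ^ 2 :=
  fun κ γ hκ hγ D hfin hE ↦ (hDel W p hp2 hadd hGM hr hfin hE κ γ hκ hγ D).2

end Cores

end Summit.BirchSwinnertonDyer.Rank1Residual.Additive

end
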